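import Summits.Schanuel.Schanuel.Theorems.ZilberEacRamifiedChart
import Summits.Schanuel.Schanuel.Theorems.ZilberEacTranscendenceDensityPole
import HarnessLib

/-!
# Polynomially parametrised base curves, LXXIV: the ANALYTIC CHART of a ramified cycle at infinity
# over a polynomial curve `t ↦ (g₀(t), g₁(t))`, and the polar form of `g(U(μ)μ^{-k})`

HONEST FRAMING.  Cell `pub-schanuel` (Zilber's Exponential-Algebraic Closedness, case ladder;
host summit Schanuel), seat 2, gen 27.  Gen 26 decided Mantova–Masser's density question over every
polynomial GRAPH `x₁ = p(x₀)` (`deg p ≥ 2`): a cycle of branches of the fibre curve at infinity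
`x₀ = s^{-k}`, `y₀ = ψ(s) → θ ≠ 0` carries EXACT exponential points with every large `k`-th-power
label, through the analytic chart `2πi·m(s)^{-k} = s^{-k} - log(ψ(s)/θ) - τ` (file LVII).  Over a
polynomially parametrised base curve `(x₀, x₁) = (g₀(t), g₁(t))` the fibre curve is `Q(t, y₀) = 0`,
its cycle at infinity is `t = s^{-k}`, `y₀ = ψ(s)`, and the exponential points `e^{x₀} = y₀` on it are
`g₀(s^{-k}) - log(ψ(s)/θ) ∈ τ + 2πiℤ`.  This file supplies the chart in that generality:
* **`exists_ramifiedChart_param`** — for `g₀ ∈ ℂ[t]` of degree `d ≥ 1`: an analytic `m` with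
  `m(0) = 0`, `m'(0) ≠ 0` and, for small `s ≠ 0`,
  `2πi · m(s)^{-kd} = g₀(s^{-k}) - log(ψ(s)/θ) - τ`
  (`m = c·s·(N(s)/lc(g₀))^{-1/(kd)}` with `N(s) = s^{kd} g₀(s^{-k}) - s^{kd}(log(ψ/θ) + τ)`,
  `N(0) = lc(g₀)`, `c^{kd} = 2πi/lc(g₀)`; principal roots as in file LVI);
* **`exists_polarForm_eval`** — for `g ∈ ℂ[t]` and `U` analytic at `0` with `U(0) ≠ 0`:
  `g(U(μ)·(μ⁻¹)^k) = U₀(μ)·(μ⁻¹)^{k·deg g}` for `μ ≠ 0`, with `U₀` analytic at `0`,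
  `U₀(0) = lc(g)·U(0)^{deg g} ≠ 0` (so the coordinate `x₀ = g₀(t)` has the polar form that THEOREM T
  of file LIX wants).
[folklore]; nothing here is specific to Schanuel's conjecture (neither used nor implied);
Mantova–Masser's question (PLMS 2024 §1 p. 5) and EC(3,2) stay OPEN.
-/

noncomputable section

open Filter Topology Polynomial Complex

set_option linter.dupNamespace false

namespace Summit.Schanuel.Schanuel.Theorems

/-! ## Part A. The polar form of `g(U(μ) μ^{-k})` -/

/-- **Polar form.**  For `g ∈ ℂ[t]`, `U` analytic at `0` and `k`: `g(U(μ)·(μ⁻¹)^k) = U₀(μ)·(μ⁻¹)^{k·deg g}`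
for all `μ ≠ 0`, where `U₀(μ) = Σ_i g_i U(μ)^i μ^{k(deg g - i)}` is analytic at `0` with
`U₀(0) = lc(g)·U(0)^{deg g}`. [folklore] -/
theorem exists_polarForm_eval (g : ℂ[X]) {U : ℂ → ℂ} (hU : AnalyticAt ℂ U 0) {k : ℕ} (hk : 1 ≤ k) :
    ∃ U₀ : ℂ → ℂ, AnalyticAt ℂ U₀ 0 ∧ U₀ 0 = g.leadingCoeff * U 0 ^ g.natDegree ∧
      ∀ μ : ℂ, μ ≠ 0 → g.eval (U μ * μ⁻¹ ^ k) = U₀ μ * μ⁻¹ ^ (k * g.natDegree) := by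
  classical
  set d := g.natDegree with hd
  set U₀ : ℂ → ℂ := fun μ => ∑ i ∈ Finset.range (d + 1), g.coeff i * U μ ^ i * μ ^ (k * (d - i))
    with hU₀
  refine ⟨U₀, ?_, ?_, fun μ hμ => ?_⟩
  · exact Finset.analyticAt_fun_sum _ fun i _ =>
      (analyticAt_const.mul (hU.pow i)).mul (analyticAt_id.pow _)
  · rw [hU₀]
    simp only
    rw [Finset.sum_eq_single_of_mem d (Finset.mem_range.2 (Nat.lt_succ_self d))]
    · rw [Nat.sub_self, mul_zero, pow_zero, mul_one, Polynomial.leadingCoeff, hd]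
    · intro i hi hid
      have hid' : i < d := lt_of_le_of_ne (Nat.lt_succ_iff.1 (Finset.mem_range.1 hi)) hid
      have hpos : k * (d - i) ≠ 0 := Nat.mul_ne_zero (by omega) (by omega)
      rw [zero_pow hpos, mul_zero]
  · have h := pow_mul_eval_mul_inv_pow_eq_sum g le_rfl k (U μ) hμ
    rw [← hd] at h
    have hμk : μ ^ (k * d) ≠ 0 := pow_ne_zero _ hμ
    rw [inv_pow _ (k * d), eq_mul_inv_iff_mul_eq₀ hμk, hU₀]
    simp only
    rw [← h, mul_comm]

/-! ## Part B. The analytic chart of a ramified cycle over a polynomial curve -/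

/-- **The analytic chart of a ramified cycle at infinity over a polynomial curve.**  `g₀ ∈ ℂ[t]` of
degree `d ≥ 1`, `ψ` analytic at `0` with `ψ(0) = θ ≠ 0`, `τ ∈ ℂ` (in the application `e^τ = θ`),
`k ≥ 1`.  There is `m` analytic at `0` with `m(0) = 0`, `m'(0) ≠ 0`, such that for all small `s`:
`ψ` is analytic and nonzero at `s`, `ψ(s)/θ` lies in the slit plane with `‖log(ψ(s)/θ)‖ < 1`, and for
`s ≠ 0`: `m(s) ≠ 0` and `2πi · (m(s)^{kd})⁻¹ = g₀((s^k)⁻¹) - log(ψ(s)/θ) - τ`.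
[folklore] (new in this form) -/
theorem exists_ramifiedChart_param (g₀ : ℂ[X]) (hd : 1 ≤ g₀.natDegree) {ψ : ℂ → ℂ}
    (hψ : AnalyticAt ℂ ψ 0) {θ : ℂ} (hθ0 : θ ≠ 0) (hψ0 : ψ 0 = θ) (τ : ℂ) {k : ℕ} (hk : 1 ≤ k) :
    ∃ m : ℂ → ℂ, AnalyticAt ℂ m 0 ∧ m 0 = 0 ∧ deriv m 0 ≠ 0 ∧
      ∀ᶠ s in 𝓝 (0 : ℂ), AnalyticAt ℂ ψ s ∧ ψ s ≠ 0 ∧ ψ s / θ ∈ Complex.slitPlane ∧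
        ‖Complex.log (ψ s / θ)‖ < 1 ∧
        (s ≠ 0 → m s ≠ 0 ∧
          (2 * Real.pi * I) * (m s ^ (k * g₀.natDegree))⁻¹ =
            g₀.eval (s ^ k)⁻¹ - Complex.log (ψ s / θ) - τ) := by
  classical
  set d := g₀.natDegree with hdd
  set K := k * d with hKdef
  have hK : 1 ≤ K := Nat.one_le_iff_ne_zero.2 (Nat.mul_ne_zero (by omega) (by omega))
  have hKC : (K : ℂ) ≠ 0 := Nat.cast_ne_zero.2 (by omega)
  have hg0 : g₀ ≠ 0 := by rintro rfl; rw [Polynomial.natDegree_zero] at hdd; omega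
  set lc : ℂ := g₀.leadingCoeff with hlc
  have hlc0 : lc ≠ 0 := Polynomial.leadingCoeff_ne_zero.2 hg0
  -- the principal `K`-th root `g(v) = (1 + v)^{-1/K}`
  set g : ℂ → ℂ := fun v => Complex.exp (-(1 / (K : ℂ)) * Complex.log (1 + v)) with hg
  have hgan : ∀ v : ℂ, ‖v‖ < 1 → AnalyticAt ℂ g v := fun v hv =>
    (analyticAt_const.mul ((analyticAt_const.add analyticAt_id).clog
      (Complex.mem_slitPlane_of_norm_lt_one hv))).cexp
  have hg0' : g 0 = 1 := by simp [hg]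
  have hgne : ∀ v, g v ≠ 0 := fun v => Complex.exp_ne_zero _
  -- the logarithm `Λ = log(ψ/θ)`
  set Λ : ℂ → ℂ := fun s => Complex.log (ψ s / θ) with hΛ
  have hquot : ContinuousAt (fun s => ψ s / θ) 0 := hψ.continuousAt.div_const θ
  have hquot0 : ψ 0 / θ = 1 := by rw [hψ0, div_self hθ0]
  have hnear₁ : ∀ᶠ s in 𝓝 (0 : ℂ), ‖ψ s / θ - 1‖ < 1 / 2 := by
    have h := hquot.tendsto
    rw [hquot0] at h
    have := (Metric.tendsto_nhds.1 h) (1 / 2) (by norm_num)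
    filter_upwards [this] with s hs
    rwa [dist_eq_norm] at hs
  have hΛan0 : AnalyticAt ℂ Λ 0 :=
    hψ.div_const.clog (mem_slitPlane_of_norm_sub_one_lt (by rw [hquot0, sub_self, norm_zero]; norm_num))
  -- the reversed polynomial function `Gr(s) = s^{K} g₀(s^{-k})` and `N = Gr - s^K (Λ + τ)`
  set Gr : ℂ → ℂ := fun s => ∑ i ∈ Finset.range (d + 1), g₀.coeff i * s ^ (k * (d - i)) with hGr
  have hGran : AnalyticAt ℂ Gr 0 :=
    Finset.analyticAt_fun_sum _ fun i _ => analyticAt_const.mul (analyticAt_id.pow _)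
  have hGr0 : Gr 0 = lc := by
    rw [hGr]
    simp only
    rw [Finset.sum_eq_single_of_mem d (Finset.mem_range.2 (Nat.lt_succ_self d))]
    · rw [Nat.sub_self, mul_zero, pow_zero, mul_one, hlc, Polynomial.leadingCoeff, hdd]
    · intro i hi hid
      have hid' : i < d := lt_of_le_of_ne (Nat.lt_succ_iff.1 (Finset.mem_range.1 hi)) hid
      have hpos : k * (d - i) ≠ 0 := Nat.mul_ne_zero (by omega) (by omega)
      rw [zero_pow hpos, mul_zero]
  have hGr_eq : ∀ s : ℂ, s ≠ 0 → s ^ K * g₀.eval (s ^ k)⁻¹ = Gr s := by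
    intro s hs
    have h := pow_mul_eval_mul_inv_pow_eq_sum g₀ le_rfl k 1 hs
    rw [← hdd, one_mul] at h
    simp only [one_pow, mul_one] at h
    rw [hKdef, ← inv_pow, h]
  set N : ℂ → ℂ := fun s => Gr s - s ^ K * (Λ s + τ) with hN
  have hNan : AnalyticAt ℂ N 0 := hGran.sub ((analyticAt_id.pow K).mul (hΛan0.add analyticAt_const))
  have hN0 : N 0 = lc := by
    simp only [hN, hGr0, zero_pow (by omega : K ≠ 0), zero_mul, sub_zero]
  -- `v = N/lc - 1`, `c^K = 2πi/lc`, `m = s · c · g(v s)`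
  set v : ℂ → ℂ := fun s => N s / lc - 1 with hv
  have hvan : AnalyticAt ℂ v 0 := hNan.div_const.sub analyticAt_const
  have hv0 : v 0 = 0 := by simp [hv, hN0, div_self hlc0]
  have h2πI : (2 * Real.pi * I : ℂ) ≠ 0 := by simp [Real.pi_ne_zero, Complex.I_ne_zero]
  set c : ℂ := Complex.exp ((1 / (K : ℂ)) * Complex.log (2 * Real.pi * I / lc)) with hc
  have hc0 : c ≠ 0 := Complex.exp_ne_zero _
  have hcK : c ^ K = 2 * Real.pi * I / lc := by
    rw [hc, ← Complex.exp_nat_mul, ← mul_assoc, show ((K : ℂ)) * (1 / (K : ℂ)) = 1 by field_simp,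
      one_mul, Complex.exp_log (div_ne_zero h2πI hlc0)]
  have hgvan : AnalyticAt ℂ (fun s => g (v s)) 0 :=
    (hgan _ (by rw [hv0, norm_zero]; exact one_pos)).comp hvan
  set F : ℂ → ℂ := fun s => c * g (v s) with hF
  have hFan : AnalyticAt ℂ F 0 := analyticAt_const.mul hgvan
  have hF0 : F 0 = c := by simp [hF, hv0, hg0']
  set m : ℂ → ℂ := fun s => s * F s with hm
  have hman : AnalyticAt ℂ m 0 := analyticAt_id.mul hFan
  have hm0 : m 0 = 0 := by simp [hm]
  have hderiv : deriv m 0 = c := by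
    rw [hm, deriv_fun_mul differentiableAt_fun_id hFan.differentiableAt]
    simp [hF0]
  have hsmall : ∀ᶠ s in 𝓝 (0 : ℂ), ‖v s‖ < 1 := by
    have h := hvan.continuousAt.tendsto
    rw [hv0] at h
    have := (Metric.tendsto_nhds.1 h) 1 one_pos
    filter_upwards [this] with s hs
    rwa [dist_zero_right] at hs
  refine ⟨m, hman, hm0, by rw [hderiv]; exact hc0, ?_⟩
  filter_upwards [hψ.eventually_analyticAt, hnear₁, hsmall] with s hsan hs1 hw
  have hψs0 : ψ s ≠ 0 := by
    intro h0
    rw [h0, zero_div, zero_sub, norm_neg, norm_one] at hs1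
    norm_num at hs1
  have hslit : ψ s / θ ∈ Complex.slitPlane := mem_slitPlane_of_norm_sub_one_lt hs1
  refine ⟨hsan, hψs0, hslit, norm_log_lt_one_of_norm_sub_one_lt hs1, fun hs0 => ?_⟩
  have hroot := kthRoot_spec hK hw
  change g (v s) ^ K * (1 + v s) = 1 at hroot
  have hsK : s ^ K ≠ 0 := pow_ne_zero _ hs0
  have hms : m s ≠ 0 := mul_ne_zero hs0 (mul_ne_zero hc0 (hgne _))
  refine ⟨hms, ?_⟩
  -- `1 + v s = N s / lc`, hence `N s ≠ 0`
  have h1v : 1 + v s = N s / lc := by rw [hv]; ring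
  have hNs : N s ≠ 0 := by
    intro h
    rw [h1v, h, zero_div, mul_zero] at hroot
    exact zero_ne_one hroot
  -- `m^K · N = 2πi · s^K`
  have hmid : m s ^ K * N s = (2 * Real.pi * I) * s ^ K := by
    have e1 : m s ^ K = s ^ K * c ^ K * g (v s) ^ K := by rw [hm, hF]; ring
    have e2 : g (v s) ^ K * N s = lc := by
      have h := hroot
      rw [h1v] at h
      field_simp at h
      linear_combination h
    have e3 : (2 * Real.pi * I / lc) * lc = 2 * Real.pi * I := div_mul_cancel₀ _ hlc0
    calc m s ^ K * N s = s ^ K * c ^ K * (g (v s) ^ K * N s) := by rw [e1]; ring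
      _ = s ^ K * (2 * Real.pi * I / lc) * lc := by rw [hcK, e2]
      _ = (2 * Real.pi * I) * s ^ K := by rw [mul_assoc, e3, mul_comm]
  have hmK : m s ^ K ≠ 0 := pow_ne_zero _ hms
  -- conclude: `2πi (m^K)⁻¹ = N / s^K = g₀(s^{-k}) - Λ - τ`
  have eN : N s = s ^ K * (g₀.eval (s ^ k)⁻¹ - Λ s - τ) := by
    rw [hN]
    simp only
    rw [← hGr_eq s hs0]
    ring
  have key : (2 * Real.pi * I) * (m s ^ K)⁻¹ = N s * (s ^ K)⁻¹ := by
    rw [eq_mul_inv_iff_mul_eq₀ hsK]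
    rw [mul_assoc, mul_comm ((m s ^ K)⁻¹) (s ^ K), ← mul_assoc]
    rw [← hmid]
    field_simp
  rw [key, eN]
  simp only [hΛ]
  field_simp

end Summit.Schanuel.Schanuel.Theorems
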